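import Mathlib

/-!
# T5FrobeniusVanishing — [A-2] of T5-SUPPORT-p3 §14(e) as a THEOREM for Mathlib's coinduced
representations: a representation with vanishing `N`-coinvariants has no non-zero map into
`CoInd_P^G τ` when `τ` is trivial on `N` (cell pub-hodge-repro2, seat p3)

`T5SplittingTwist` (file 22, §5) proved [A-2] with Frobenius reciprocity taken as a hypothesis
(an equivalence `Hom(π, i τ) ≃ Hom(r π, τ)`). Here the relevant half of Frobenius reciprocity is
PROVED for Mathlib's `Representation.coind` (the functions `f : G → W` with `f (p g) = τ p (f g)`,
`G` acting by right translation) — the abstract, non-topological form of induction: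

* `evalOne Φ`: a `G`-intertwining map `Φ : π → coind P.subtype τ` restricts, by evaluation at
  `1`, to a `P`-intertwining map `π|_P → τ` (`isIntertwiningMap_evalOne`), and `Φ` is recovered
  from it: `(Φ v) g = evalOne Φ (π g v)` (`coe_apply_eq_evalOne`) — so `Φ = 0 ↔ evalOne Φ = 0`
  (`eq_zero_iff_evalOne_eq_zero`): the injective half of `Hom_G(π, CoInd τ) ≃ Hom_P(π, τ)`.
* `evalOne_eq_zero_of_coinvariants`: if `τ` is trivial on a subgroup `N ≤ P` and the
  `N`-coinvariants of `π` vanish (`Coinvariants.ker (π.comp N.subtype) = ⊤`, «the Jacquet module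
  is zero»), then `evalOne Φ = 0` — a `P`-map into an `N`-trivial target factors through `π_N`.
* `intertwiningMap_coind_eq_zero`: hence `Φ = 0`; `not_injective_of_coinvariants`: no non-zero
  `π` with `π_N = 0` embeds `G`-equivariantly into `coind P.subtype τ` — [A-2].

Honest scope: Mathlib's `coind` is the full function-space induction of abstract groups; the
passage to MVW's smooth (unnormalised or normalised) induction of p-adic groups — smooth vectors,
the modulus character, admissibility — and Q-9 («sub ⟺ quotient for cuspidal π») stay prose.
Mathlib only; standard axioms.
-/

namespace Summit.Ventures.HodgeRepro2.T5FrobeniusVanishing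

open Representation

variable {k G V W : Type*} [CommRing k] [Group G] [AddCommGroup V] [Module k V]
  [AddCommGroup W] [Module k W]

/-- Evaluation at `1 : G` of a linear map into the coinduced module: `v ↦ (Φ v) 1`. -/
def evalOne {P : Subgroup G} (τ : Representation k P W)
    (Φ : V →ₗ[k] coindV P.subtype τ) : V →ₗ[k] W :=
  LinearMap.proj (1 : G) ∘ₗ (coindV P.subtype τ).subtype ∘ₗ Φ

/-- `evalOne Φ v = (Φ v) 1`. -/
theorem evalOne_apply {P : Subgroup G} (τ : Representation k P W)
    (Φ : V →ₗ[k] coindV P.subtype τ) (v : V) : evalOne τ Φ v = (Φ v : G → W) 1 := rfl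

/-- The defining property of `coindV` at `h = 1`: `f p = τ p (f 1)` for `p ∈ P`. -/
theorem coe_apply_subtype {P : Subgroup G} (τ : Representation k P W)
    (f : coindV P.subtype τ) (p : P) : (f : G → W) (p : G) = τ p ((f : G → W) 1) := by
  have h := (mem_coindV P.subtype τ (f : G → W)).mp f.2 p 1
  simpa using h

/-- A `G`-intertwining map `Φ : π → coind P.subtype τ` is recovered from `evalOne Φ`:
`(Φ v) g = evalOne Φ (π g v)`. -/
theorem coe_apply_eq_evalOne {P : Subgroup G} (π : Representation k G V)
    (τ : Representation k P W) (Φ : V →ₗ[k] coindV P.subtype τ)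
    (hΦ : IsIntertwiningMap π (coind P.subtype τ) Φ) (v : V) (g : G) :
    (Φ v : G → W) g = evalOne τ Φ (π g v) := by
  rw [evalOne_apply, hΦ.isIntertwining g v]
  simp [coind]

/-- `Φ = 0` if and only if `evalOne Φ = 0` (the injective half of Frobenius reciprocity). -/
theorem eq_zero_iff_evalOne_eq_zero {P : Subgroup G} (π : Representation k G V)
    (τ : Representation k P W) (Φ : V →ₗ[k] coindV P.subtype τ)
    (hΦ : IsIntertwiningMap π (coind P.subtype τ) Φ) : Φ = 0 ↔ evalOne τ Φ = 0 := by
  constructor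
  · intro h
    rw [h]
    ext v
    simp [evalOne_apply]
  · intro h
    ext v g
    rw [coe_apply_eq_evalOne π τ Φ hΦ v g, h]
    rfl

/-- `evalOne Φ` is `P`-intertwining from `π|_P` to `τ`. -/
theorem isIntertwiningMap_evalOne {P : Subgroup G} (π : Representation k G V)
    (τ : Representation k P W) (Φ : V →ₗ[k] coindV P.subtype τ)
    (hΦ : IsIntertwiningMap π (coind P.subtype τ) Φ) :
    IsIntertwiningMap (π.comp P.subtype) τ (evalOne τ Φ) := by
  refine ⟨fun p v => ?_⟩
  rw [evalOne_apply, evalOne_apply]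
  have h1 : (Φ ((π.comp P.subtype) p v) : G → W) 1 = (Φ v : G → W) (p : G) := by
    rw [coe_apply_eq_evalOne π τ Φ hΦ v (p : G), evalOne_apply]
    rfl
  rw [h1, coe_apply_subtype]

/-- If `τ` is trivial on `N ≤ P`, every `P`-intertwining map `ψ : π|_P → τ` kills the
generators `π n v - v` (`n ∈ N`) of the `N`-coinvariants kernel. -/
theorem intertwiningMap_sub_mem_ker {P N : Subgroup G} (hNP : N ≤ P) (π : Representation k G V)
    (τ : Representation k P W) (hτ : ∀ n : N, τ ⟨n, hNP n.2⟩ = 1)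
    (ψ : V →ₗ[k] W) (hψ : IsIntertwiningMap (π.comp P.subtype) τ ψ) (n : N) (v : V) :
    ψ (π n v - v) = 0 := by
  rw [map_sub]
  have h := hψ.isIntertwining ⟨n, hNP n.2⟩ v
  simp only [MonoidHom.coe_comp, Function.comp_apply, Subgroup.coe_subtype] at h
  rw [h, hτ n, Module.End.one_apply, sub_self]

/-- A `P`-intertwining map into an `N`-trivial target vanishes on `Coinvariants.ker (π|_N)`. -/
theorem coinvariantsKer_le_ker {P N : Subgroup G} (hNP : N ≤ P) (π : Representation k G V)
    (τ : Representation k P W) (hτ : ∀ n : N, τ ⟨n, hNP n.2⟩ = 1)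
    (ψ : V →ₗ[k] W) (hψ : IsIntertwiningMap (π.comp P.subtype) τ ψ) :
    Coinvariants.ker (π.comp N.subtype) ≤ LinearMap.ker ψ := by
  unfold Coinvariants.ker
  refine Submodule.span_le.mpr ?_
  rintro w ⟨⟨n, v⟩, rfl⟩
  exact intertwiningMap_sub_mem_ker hNP π τ hτ ψ hψ n v

/-- «The Jacquet module vanishes» (`Coinvariants.ker (π|_N) = ⊤`) forces every `P`-intertwining
map into an `N`-trivial target to be zero. -/
theorem intertwiningMap_eq_zero_of_coinvariants {P N : Subgroup G} (hNP : N ≤ P)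
    (π : Representation k G V) (τ : Representation k P W) (hτ : ∀ n : N, τ ⟨n, hNP n.2⟩ = 1)
    (hJ : Coinvariants.ker (π.comp N.subtype) = ⊤)
    (ψ : V →ₗ[k] W) (hψ : IsIntertwiningMap (π.comp P.subtype) τ ψ) : ψ = 0 := by
  have h := coinvariantsKer_le_ker hNP π τ hτ ψ hψ
  rw [hJ, top_le_iff] at h
  exact LinearMap.ker_eq_top.mp h

/-- `evalOne Φ = 0` when `π_N = 0` and `τ` is `N`-trivial. -/
theorem evalOne_eq_zero_of_coinvariants {P N : Subgroup G} (hNP : N ≤ P)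
    (π : Representation k G V) (τ : Representation k P W) (hτ : ∀ n : N, τ ⟨n, hNP n.2⟩ = 1)
    (hJ : Coinvariants.ker (π.comp N.subtype) = ⊤)
    (Φ : V →ₗ[k] coindV P.subtype τ) (hΦ : IsIntertwiningMap π (coind P.subtype τ) Φ) :
    evalOne τ Φ = 0 :=
  intertwiningMap_eq_zero_of_coinvariants hNP π τ hτ hJ (evalOne τ Φ)
    (isIntertwiningMap_evalOne π τ Φ hΦ)

/-- [A-2], coinduced form: if `π_N = 0` and `τ` is `N`-trivial, every `G`-intertwining map
`π → coind P.subtype τ` is zero. -/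
theorem intertwiningMap_coind_eq_zero {P N : Subgroup G} (hNP : N ≤ P)
    (π : Representation k G V) (τ : Representation k P W) (hτ : ∀ n : N, τ ⟨n, hNP n.2⟩ = 1)
    (hJ : Coinvariants.ker (π.comp N.subtype) = ⊤)
    (Φ : V →ₗ[k] coindV P.subtype τ) (hΦ : IsIntertwiningMap π (coind P.subtype τ) Φ) :
    Φ = 0 :=
  (eq_zero_iff_evalOne_eq_zero π τ Φ hΦ).mpr (evalOne_eq_zero_of_coinvariants hNP π τ hτ hJ Φ hΦ)

/-- Consequently no non-zero `π` with `π_N = 0` embeds `G`-equivariantly into `coind P.subtype τ`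
for an `N`-trivial `τ` («a cuspidal representation is not a sub-representation of a
representation induced from a parabolic whose unipotent radical acts trivially on `τ`»). -/
theorem not_injective_of_coinvariants {P N : Subgroup G} (hNP : N ≤ P) [Nontrivial V]
    (π : Representation k G V) (τ : Representation k P W) (hτ : ∀ n : N, τ ⟨n, hNP n.2⟩ = 1)
    (hJ : Coinvariants.ker (π.comp N.subtype) = ⊤)
    (Φ : V →ₗ[k] coindV P.subtype τ) (hΦ : IsIntertwiningMap π (coind P.subtype τ) Φ) :
    ¬ Function.Injective Φ := by
  intro hinj
  have h0 : Φ = 0 := intertwiningMap_coind_eq_zero hNP π τ hτ hJ Φ hΦ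
  obtain ⟨x, hx⟩ := exists_ne (0 : V)
  apply hx
  apply hinj
  rw [h0]
  rfl

/-- The `N`-triviality hypothesis holds for the inflation of a representation of the Levi
quotient: if `τ = τ̄ ∘ q` with `q : P →* M` and `N ≤ P` maps to `1` under `q`, then `τ` is
`N`-trivial. -/
theorem trivial_on_of_comp {P N : Subgroup G} (hNP : N ≤ P) {M : Type*} [Group M]
    (q : P →* M) (τ' : Representation k M W) (hq : ∀ n : N, q ⟨n, hNP n.2⟩ = 1) (n : N) :
    (τ'.comp q) ⟨n, hNP n.2⟩ = 1 := by
  simp [hq n]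

end Summit.Ventures.HodgeRepro2.T5FrobeniusVanishing
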